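import Literature.Probability.RandomPlanarGeometry.HullRestrictionNull
import Literature.Probability.RandomPlanarGeometry.HullRestrictionTests
import Literature.Probability.RandomPlanarGeometry.SLELawTransport
import Literature.Probability.RandomPlanarGeometry.ConformalRestrictionAssembly
import HarnessLib

/-!
# [LSW] Theorem 6.1 transposed: two-sided restriction of the chordal SLE_{8/3} laws

The assembly of the transposition of

* G. F. Lawler, O. Schramm, W. Werner, *Conformal restriction: the chordal case*, J. Amer.
  Math. Soc. **16** (2003) 917–955, arXiv:math/0209343 (**[LSW]**), Thm. 6.1 (p. 23):
  "Let `γ` be the SLE_{8/3} path starting at the origin and `A ∈ 𝒬*`, then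
  `P[γ[0, ∞) ∩ A = ∅] = Φ'_A(0)^{5/8}`. The law of `γ(0, ∞)` is therefore `P_{5/8}`",

from its verbatim half-plane form `Literature.Probability.RandomPlanarGeometry.sle_restriction_eightThirds` (`RestrictionHulls`) to the
tree's Dobrushin-domain form `Literature.Probability.RandomPlanarGeometry.IsSLELaw.hullRestriction_eightThirds`
(`ConformalRestrictionProofs`): for the chordal SLE_{8/3} laws `μ`, `μ'` of `(D; a, b)` and of
a hull subdomain `D'`, `μ' (T) · μ {Γ ⊆ cl D'} = μ (T ∩ {Γ ⊆ cl D'})` for every Borel `T`.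

**Proof** (`IsSLELaw.hullRestriction_eightThirds_of_facts`). Write `μ = law of Γ = φ(γ)`
(`φ` a chordal uniformizing map of `D`, `γ` the SLE_{8/3} trace), `A = closure (ℍ ∖ φ⁻¹ D')`
the pulled-back `*`-hull (`HullSubdomainPullback`), `Φ_A` its restriction map,
`ψ = φ ∘ Φ_A⁻¹` — a chordal uniformizing map of `D'` — and `μ' = law of Γ' = ψ(γ)` (uniqueness
in law, `SLELawTransport`).
1. `{Γ ⊆ cl D'}` and `{γ ∩ A = ∅}` agree a.s. (`HullRestrictionNull`, from Thm. 6.1 and the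
   kernel continuity of `Φ'_·(0)`), and on this event `Γ` is a chordal simple curve of `D'`
   (`chordalCarrier`, Rohde–Schramm: the trace is simple).
2. Both sides of the identity are finite measures in `T` carried by `chordalCarrier D'`; by the
   transfer theorem `CurveClass.Measure.ext_of_missCode_injOn` (`SimpleCurveLaws`, Lusin–Souslin;
   the curve-space form of [LSW] Lemma 3.2) and the injectivity of the avoidance code of the
   image test sets `ψ(S)` (`HullRestrictionTests`) it suffices to check `T = {Γ ∩ ψ(S) = ∅}` for
   the anchored rational test sets `S` of the half-plane (`HalfPlaneAnchors`).
3. For those: `μ' {Γ' ∩ ψ(S) = ∅} = P[γ ∩ S = ∅] = P[γ ∩ Fill(S) = ∅]` (`HalfPlaneFill`), and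
   `μ ({Γ ∩ ψ(S) = ∅} ∩ {Γ ⊆ cl D'}) = P[γ ∩ A = ∅, Φ_A(γ) ∩ Fill(S) = ∅]
   = P[γ ∩ A = ∅] · P[γ ∩ Fill(S) = ∅]` by [LSW] Thm. 6.1 with the semigroup identity
   `Φ'_{A·B}(0) = Φ'_A(0) Φ'_B(0)` (`RestrictionSemigroup`, the proof of Prop. 3.3 (3) ⇒ (1)),
   which is `μ {Γ ⊆ cl D'} · μ' {Γ' ∩ ψ(S) = ∅}`.

The remaining hypotheses are the printed theorems: [LSW] Thm. 6.1 (`h61`), existence and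
uniqueness of `Φ_A` and of `Φ'_A(0) ∈ (0, 1]` ([LSW] §2, Riemann mapping; `hexΦ`, `hex`), the
kernel continuity of `Φ'_·(0)` ([LSW] Lemma 3.5; `hFc`), the classical criterion for simple
connectivity (Conway VIII.2.2; `hFa`), Jordan–Schoenflies (`hsc`), the Jordan curve and arc
theorems (`hJ`, `hJarc`), the Riemann mapping theorem (`hRM`), Carathéodory's theorem (`hC`),
and the Rohde–Schramm facts on the trace (existence `hκt`, simplicity `h₆`, transience `htr`,
uniqueness in law `h₃`, marginal measurability `hmeas`).
-/

noncomputable section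

open Set Filter Topology Metric MeasureTheory Complex
open UpperHalfPlane (upperHalfPlaneSet isOpen_upperHalfPlaneSet)
open scoped NNReal ENNReal unitInterval

namespace Literature.Probability.RandomPlanarGeometry

/-! ### The trace of the compactified image of a half-plane path -/

section PathImage

variable {D : DobrushinDomain} {φ : ConformalEquiv upperHalfPlaneSet D.carrier}
  {γ : ℝ≥0 → ℂ} {c : Curve ℂ}

/-- The points of the trace of the time-compactified image `c` of `γ` under `Ψ` with endpoint
`b` are `b` and the points `Ψ (γ t)`. [folklore] -/
theorem IsCompactifiedImage.mem_range_iff {Ψ : ℂ → ℂ} {b : ℂ} (hc : IsCompactifiedImage Ψ γ b c)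
    {w : ℂ} : w ∈ c.range ↔ w = b ∨ ∃ t, w = Ψ (γ t) := by
  constructor
  · rintro ⟨s, rfl⟩
    by_cases hs : (s : ℝ) < 1
    · exact Or.inr ⟨rayParam s, hc.1 s hs⟩
    · exact Or.inl (by rw [unitInterval.eq_one_of_not_lt hs, hc.2])
  · rintro (rfl | ⟨t, rfl⟩)
    · exact ⟨1, hc.2⟩
    · obtain ⟨s, hs, hst⟩ := exists_rayParam_eq t
      exact ⟨s, by rw [hc.1 s hs, hst]⟩

/-- The trace of the compactified image under a chordal uniformizing map of a path in
`ℍ ∪ {0}` from `0` lies in `D ∪ {a, b}`. [folklore] -/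
theorem IsCompactifiedImage.range_subset (hφ : D.IsChordalUniformizing φ) (h0 : γ 0 = 0)
    (hH : ∀ t, 0 < t → 0 < (γ t).im)
    (hc : IsCompactifiedImage φ.boundaryExtension γ (D.pt 1) c) :
    c.range ⊆ D.carrier ∪ {D.pt 0, D.pt 1} := by
  intro w hw
  rcases hc.mem_range_iff.1 hw with rfl | ⟨t, rfl⟩
  · exact Or.inr (Or.inr rfl)
  · rcases eq_or_ne t 0 with rfl | ht
    · rw [h0, hφ.boundaryExtension_zero]
      exact Or.inr (Or.inl rfl)
    · have ht' : 0 < t := pos_iff_ne_zero.2 ht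
      rw [φ.boundaryExtension_eq (show γ t ∈ upperHalfPlaneSet from hH t ht')]
      exact Or.inl (φ.mapsTo (show γ t ∈ upperHalfPlaneSet from hH t ht'))

/-- The points of that trace inside `D` are the `φ (γ t)`, `t > 0`. [folklore] -/
theorem IsCompactifiedImage.mem_range_inter_iff (hφ : D.IsChordalUniformizing φ) (h0 : γ 0 = 0)
    (hH : ∀ t, 0 < t → 0 < (γ t).im)
    (hc : IsCompactifiedImage φ.boundaryExtension γ (D.pt 1) c) {w : ℂ} :
    w ∈ c.range ∩ D.carrier ↔ ∃ t, 0 < t ∧ w = φ (γ t) := by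
  constructor
  · rintro ⟨hw, hwD⟩
    rcases hc.mem_range_iff.1 hw with rfl | ⟨t, rfl⟩
    · exact absurd hwD (D.pt_notMem_carrier 1)
    · rcases eq_or_ne t 0 with rfl | ht
      · rw [h0, hφ.boundaryExtension_zero] at hwD
        exact absurd hwD (D.pt_notMem_carrier 0)
      · have ht' : 0 < t := pos_iff_ne_zero.2 ht
        exact ⟨t, ht', φ.boundaryExtension_eq (show γ t ∈ upperHalfPlaneSet from hH t ht')⟩
  · rintro ⟨t, ht, rfl⟩
    refine ⟨?_, φ.mapsTo (show γ t ∈ upperHalfPlaneSet from hH t ht)⟩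
    rw [← φ.boundaryExtension_eq (show γ t ∈ upperHalfPlaneSet from hH t ht)]
    exact hc.mem_range_iff.2 (Or.inr ⟨t, rfl⟩)

/-- **Avoidance of an image test set is avoidance of the test set.** For `S ⊆ ℍ̄` with `0 ∉ S`
the class of the compactified image avoids `φ.boundaryExtension '' S` iff `γ` avoids `S`
(boundary correspondence, `MarkedDomain.disjoint_image_boundaryExtension_iff`). [folklore] -/
theorem IsCompactifiedImage.mk_mem_rangeSubset_compl_image_iff (hφ : D.IsChordalUniformizing φ)
    (h0 : γ 0 = 0) (hH : ∀ t, 0 < t → 0 < (γ t).im)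
    (hc : IsCompactifiedImage φ.boundaryExtension γ (D.pt 1) c)
    (hC : JordanDomain.exists_continuousOn_extension) {S : Set ℂ}
    (hS : S ⊆ closure upperHalfPlaneSet) (h0S : (0 : ℂ) ∉ S) :
    CurveClass.mk c ∈ CurveClass.rangeSubset (φ.boundaryExtension '' S)ᶜ ↔
      Disjoint (range γ) S := by
  rw [CurveClass.mem_rangeSubset, CurveClass.range_mk, subset_compl_iff_disjoint_right,
    MarkedDomain.disjoint_image_boundaryExtension_iff hC hφ hS h0S (hc.range_subset hφ h0 hH)]
  constructor
  · intro h
    refine Set.disjoint_left.2 ?_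
    rintro _ ⟨t, rfl⟩ htS
    rcases eq_or_ne t 0 with rfl | ht
    · exact h0S (h0 ▸ htS)
    · have ht' : 0 < t := pos_iff_ne_zero.2 ht
      have h1 := h (φ (γ t)) ((hc.mem_range_inter_iff hφ h0 hH).2 ⟨t, ht', rfl⟩)
      rw [φ.symm_apply_apply (show γ t ∈ upperHalfPlaneSet from hH t ht')] at h1
      exact h1 htS
  · intro h w hw
    obtain ⟨t, ht, rfl⟩ := (hc.mem_range_inter_iff hφ h0 hH).1 hw
    rw [φ.symm_apply_apply (show γ t ∈ upperHalfPlaneSet from hH t ht)]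
    exact Set.disjoint_left.1 h (mem_range_self t)

end PathImage

/-! ### The pulled-back hull and the trace -/

section Pullback

variable {D D' : DobrushinDomain} {φ : ConformalEquiv upperHalfPlaneSet D.carrier}
  {γ : ℝ≥0 → ℂ} {c : Curve ℂ}

/-- A point of `ℍ` mapped into `closure D'` lies in `closure (φ⁻¹ D')` (`D' ⊆ D`, `φ⁻¹`
continuous on `D`). [folklore] -/
theorem ConformalEquiv.mem_closure_pullbackDomain_of_apply {z : ℂ} (hz : z ∈ upperHalfPlaneSet)
    (hsub : D'.carrier ⊆ D.carrier) (h : φ z ∈ closure D'.carrier) :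
    z ∈ closure (φ.pullbackDomain D') := by
  have h1 : ContinuousWithinAt φ.symm D'.carrier (φ z) :=
    (φ.symm.continuousOn.continuousAt (D.isOpen.mem_nhds (φ.mapsTo hz))).continuousWithinAt
  have h2 := h1.mem_closure_image h
  rw [φ.symm_apply_apply hz] at h2
  refine closure_mono ?_ h2
  rintro _ ⟨w, hw, rfl⟩
  exact ConformalEquiv.symm_mapsTo_pullbackDomain hsub hw

/-- A subset of `D' ∪ {a', b'}` lies in `closure D'`. [folklore] -/
theorem subset_closure_of_subset_carrier_union {R : Set ℂ}
    (h : R ⊆ D'.carrier ∪ {D'.pt 0, D'.pt 1}) : R ⊆ closure D'.carrier := by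
  intro w hw
  rcases h hw with h' | h'
  · exact subset_closure h'
  · rcases h' with rfl | rfl <;> exact frontier_subset_closure (D'.pt_mem_frontier _)

/-- A subset of `closure D'` meeting `∂D'` only inside `{a', b'}` lies in `D' ∪ {a', b'}`.
[folklore] -/
theorem subset_carrier_union_of_inter_frontier {R : Set ℂ} (h1 : R ⊆ closure D'.carrier)
    (h2 : R ∩ frontier D'.carrier ⊆ {D'.pt 0, D'.pt 1}) :
    R ⊆ D'.carrier ∪ {D'.pt 0, D'.pt 1} := by
  intro w hw
  have h3 := h1 hw
  rw [closure_eq_self_union_frontier] at h3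
  rcases h3 with h3 | h3
  · exact Or.inl h3
  · exact Or.inr (h2 ⟨hw, h3⟩)

/-- **The trace avoids the pulled-back hull iff its image is a chordal trace of `D'`.** For a
path `γ` in `ℍ ∪ {0}` from `0`, a chordal uniformizing map `φ` of `(D; a, b)`, a hull subdomain
`D'` and the compactified image `c` of `γ`: `γ ∩ A = ∅` for `A = closure (ℍ ∖ φ⁻¹ D')` iff
the trace of `c` lies in `D' ∪ {a, b}`. [folklore] -/
theorem disjoint_range_pullbackHull_iff (hφ : D.IsChordalUniformizing φ)
    (hD' : D.IsHullSubdomain D') (h0 : γ 0 = 0) (hH : ∀ t, 0 < t → 0 < (γ t).im)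
    (hc : IsCompactifiedImage φ.boundaryExtension γ (D.pt 1) c) :
    Disjoint (range γ) (φ.pullbackHull D') ↔ c.range ⊆ D'.carrier ∪ {D'.pt 0, D'.pt 1} := by
  have hA0 : (0 : ℂ) ∉ φ.pullbackHull D' := ConformalEquiv.zero_notMem_pullbackHull hφ hD'
  constructor
  · intro h w hw
    rcases hc.mem_range_iff.1 hw with rfl | ⟨t, rfl⟩
    · rw [← hD'.pt_one_eq]
      exact Or.inr (Or.inr rfl)
    · rcases eq_or_ne t 0 with rfl | ht
      · rw [h0, hφ.boundaryExtension_zero, ← hD'.pt_zero_eq]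
        exact Or.inr (Or.inl rfl)
      · have ht' : 0 < t := pos_iff_ne_zero.2 ht
        have hmem : γ t ∈ φ.pullbackDomain D' := by
          rw [← ConformalEquiv.diff_pullbackHull]
          exact ⟨hH t ht', Set.disjoint_left.1 h (mem_range_self t)⟩
        rw [φ.boundaryExtension_eq (show γ t ∈ upperHalfPlaneSet from hH t ht')]
        exact Or.inl hmem.2
  · intro h
    refine Set.disjoint_left.2 ?_
    rintro _ ⟨t, rfl⟩ htA
    rcases eq_or_ne t 0 with rfl | ht
    · exact hA0 (h0 ▸ htA)
    · have ht' : 0 < t := pos_iff_ne_zero.2 ht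
      have hw : φ (γ t) ∈ c.range ∩ D.carrier :=
        (hc.mem_range_inter_iff hφ h0 hH).2 ⟨t, ht', rfl⟩
      have hwD' : φ (γ t) ∈ D'.carrier := by
        rcases h hw.1 with h' | h'
        · exact h'
        · rcases h' with h' | h'
          · rw [hD'.pt_zero_eq] at h'
            exact absurd (h' ▸ hw.2) (D.pt_notMem_carrier 0)
          · rw [hD'.pt_one_eq] at h'
            exact absurd (h' ▸ hw.2) (D.pt_notMem_carrier 1)
      have hmem : γ t ∈ upperHalfPlaneSet \ φ.pullbackHull D' := by
        rw [ConformalEquiv.diff_pullbackHull]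
        exact ⟨hH t ht', hwD'⟩
      exact hmem.2 htA

/-- If the image trace lies in `closure D'` then `γ(0, ∞) ⊆ closure (φ⁻¹ D')`. [folklore] -/
theorem forall_mem_closure_pullbackDomain (hsub : D'.carrier ⊆ D.carrier)
    (hH : ∀ t, 0 < t → 0 < (γ t).im)
    (hc : IsCompactifiedImage φ.boundaryExtension γ (D.pt 1) c)
    (h : c.range ⊆ closure D'.carrier) (t : ℝ≥0) (ht : 0 < t) :
    γ t ∈ closure (φ.pullbackDomain D') := by
  refine ConformalEquiv.mem_closure_pullbackDomain_of_apply (hH t ht) hsub (h ?_)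
  rw [← φ.boundaryExtension_eq (show γ t ∈ upperHalfPlaneSet from hH t ht)]
  exact hc.mem_range_iff.2 (Or.inr ⟨t, rfl⟩)

/-- **On `{γ ∩ A = ∅}`, avoidance of the image test set `ψ(S)` by `φ(γ)` is avoidance of `S`
by `Φ_A(γ)`**, for `ψ` with `ψ⁻¹ = Φ_A ∘ φ⁻¹` on `D'` (i.e. `ψ = φ ∘ Φ_A⁻¹`), a chordal
uniformizing map of `D'`; `S ⊆ ℍ̄`, `0 ∉ S`. [folklore] -/
theorem mk_mem_rangeSubset_compl_image_iff_of_disjoint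
    (hC : JordanDomain.exists_continuousOn_extension) (hφ : D.IsChordalUniformizing φ)
    (hD' : D.IsHullSubdomain D')
    {Φ : ConformalEquiv (upperHalfPlaneSet \ φ.pullbackHull D') upperHalfPlaneSet}
    {ψ : ConformalEquiv upperHalfPlaneSet D'.carrier} (hψ : D'.IsChordalUniformizing ψ)
    (hψsymm : ∀ w, ψ.symm w = Φ (φ.symm w)) (h0 : γ 0 = 0) (hH : ∀ t, 0 < t → 0 < (γ t).im)
    (hc : IsCompactifiedImage φ.boundaryExtension γ (D.pt 1) c)
    (hA : Disjoint (range γ) (φ.pullbackHull D')) {S : Set ℂ}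
    (hS : S ⊆ closure upperHalfPlaneSet) (h0S : (0 : ℂ) ∉ S) :
    CurveClass.mk c ∈ CurveClass.rangeSubset (ψ.boundaryExtension '' S)ᶜ ↔
      ∀ t, 0 < t → Φ (γ t) ∉ S := by
  have hR := (disjoint_range_pullbackHull_iff hφ hD' h0 hH hc).1 hA
  rw [CurveClass.mem_rangeSubset, CurveClass.range_mk, subset_compl_iff_disjoint_right,
    MarkedDomain.disjoint_image_boundaryExtension_iff hC hψ hS h0S hR]
  have hin : ∀ t, 0 < t → φ (γ t) ∈ D'.carrier := fun t ht ↦ by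
    have hmem : γ t ∈ upperHalfPlaneSet \ φ.pullbackHull D' :=
      ⟨hH t ht, Set.disjoint_left.1 hA (mem_range_self t)⟩
    rw [ConformalEquiv.diff_pullbackHull] at hmem
    exact hmem.2
  constructor
  · intro h t ht htS
    have h1 := h (φ (γ t)) ⟨((hc.mem_range_inter_iff hφ h0 hH).2 ⟨t, ht, rfl⟩).1, hin t ht⟩
    rw [hψsymm, φ.symm_apply_apply (show γ t ∈ upperHalfPlaneSet from hH t ht)] at h1
    exact h1 htS
  · rintro h w ⟨hw, hwD'⟩
    obtain ⟨t, ht, rfl⟩ := (hc.mem_range_inter_iff hφ h0 hH).1 ⟨hw, hD'.carrier_subset hwD'⟩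
    rw [hψsymm, φ.symm_apply_apply (show γ t ∈ upperHalfPlaneSet from hH t ht)]
    exact h t ht

end Pullback

/-! ### The pushed path `Φ_A ∘ γ` and fills -/

section Push

variable {A : Set ℂ} {Φ : ConformalEquiv (upperHalfPlaneSet \ A) upperHalfPlaneSet}
  {γ : ℝ≥0 → ℂ}

/-- **The pushed path avoids the fill of what it avoids.** Let `γ` be a transient path in
`ℍ ∪ {0}` from `0` avoiding the closed set `A`, `Φ = Φ_A` a restriction map, and `S ∌ 0` closed
and bounded. If `Φ (γ t) ∉ S` for all `t > 0` then `0 ∉ Fill(S)` and `Φ (γ t) ∉ Fill(S)` for all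
`t > 0`: the path `Φ ∘ γ` (value `0` at `0`; continuous since `Φ_A(z) → 0` as `z → 0`, transient
since `Φ_A(z) → ∞` as `z → ∞`) is a transient path from `0` in `ℍ ∪ {0}` avoiding `S`
(`HalfPlaneFill.disjoint_range_hpFill_iff`). [folklore] -/
theorem IsRestrictionMap.forall_notMem_hpFill (hAc : IsClosed A) (hΦ : IsRestrictionMap A Φ)
    (hγc : Continuous γ) (h0 : γ 0 = 0) (hH : ∀ t, 0 < t → 0 < (γ t).im)
    (htr : Tendsto (fun t ↦ ‖γ t‖) atTop atTop) (hA : Disjoint (range γ) A) {S : Set ℂ}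
    (hS : IsClosed S) (hSb : Bornology.IsBounded S) (h0S : (0 : ℂ) ∉ S)
    (h : ∀ t, 0 < t → Φ (γ t) ∉ S) :
    (0 : ℂ) ∉ hpFill S ∧ ∀ t, 0 < t → Φ (γ t) ∉ hpFill S := by
  classical
  -- the pushed path
  set η : ℝ≥0 → ℂ := fun t ↦ if t = 0 then 0 else Φ (γ t) with hη
  have hη0 : η 0 = 0 := if_pos rfl
  have hηpos : ∀ {t : ℝ≥0}, 0 < t → η t = Φ (γ t) := fun ht ↦ if_neg ht.ne'
  have hmem : ∀ t, 0 < t → γ t ∈ upperHalfPlaneSet \ A := fun t ht ↦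
    ⟨hH t ht, Set.disjoint_left.1 hA (mem_range_self t)⟩
  have hηH : ∀ t, 0 < t → 0 < (η t).im := fun t ht ↦ by
    rw [hηpos ht]
    exact Φ.mapsTo (hmem t ht)
  have hopen : IsOpen (upperHalfPlaneSet \ A) := isOpen_upperHalfPlaneSet.sdiff hAc
  -- continuity
  have hηc : Continuous η := by
    rw [continuous_iff_continuousAt]
    intro t
    rcases eq_or_ne t 0 with rfl | ht
    · rw [← continuousWithinAt_compl_self, ContinuousWithinAt, hη0]
      have hγ0 : Tendsto γ (𝓝[≠] 0) (𝓝[upperHalfPlaneSet \ A] 0) := by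
        refine tendsto_nhdsWithin_iff.2 ⟨?_, ?_⟩
        · have h1 : ContinuousAt γ 0 := hγc.continuousAt
          rw [ContinuousAt, h0] at h1
          exact h1.mono_left nhdsWithin_le_nhds
        · filter_upwards [self_mem_nhdsWithin] with s hs
          exact hmem s (pos_iff_ne_zero.2 hs)
      refine (hΦ.1.comp hγ0).congr' ?_
      filter_upwards [self_mem_nhdsWithin] with s hs
      exact (hηpos (pos_iff_ne_zero.2 hs)).symm
    · have hev : η =ᶠ[𝓝 t] fun s ↦ Φ (γ s) :=
        eventually_of_mem (isOpen_ne.mem_nhds ht) fun s hs ↦ hηpos (pos_iff_ne_zero.2 hs)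
      refine ContinuousAt.congr ?_ hev.symm
      exact (Φ.continuousOn.continuousAt (hopen.mem_nhds (hmem t (pos_iff_ne_zero.2 ht)))).comp
        hγc.continuousAt
  -- transience
  have hηtr : Tendsto (fun t ↦ ‖η t‖) atTop atTop := by
    have h1 : Tendsto γ atTop (cocompact ℂ ⊓ 𝓟 (upperHalfPlaneSet \ A)) :=
      tendsto_inf.2 ⟨tendsto_cocompact_of_tendsto_norm_atTop htr,
        tendsto_principal.2 ((eventually_gt_atTop 0).mono fun t ht ↦ hmem t ht)⟩
    have h2 := tendsto_norm_cocompact_atTop.comp (hΦ.tendsto_cocompact.comp h1)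
    refine h2.congr' ?_
    filter_upwards [eventually_gt_atTop 0] with t ht
    simp only [Function.comp_apply, hηpos ht]
  -- `η` avoids `S`
  have hdisj : Disjoint (range η) S := by
    refine Set.disjoint_left.2 ?_
    rintro _ ⟨t, rfl⟩ htS
    rcases eq_or_ne t 0 with rfl | ht
    · exact h0S (hη0 ▸ htS)
    · rw [hηpos (pos_iff_ne_zero.2 ht)] at htS
      exact h t (pos_iff_ne_zero.2 ht) htS
  refine ⟨zero_notMem_hpFill_of_disjoint hS hηc hη0 hηH hηtr hdisj, fun t ht hF ↦ ?_⟩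
  have h2 := (disjoint_range_hpFill_iff hS hSb h0S hηc hη0 hηH hηtr).2 hdisj
  refine Set.disjoint_left.1 h2 (mem_range_self t) ?_
  rw [hηpos ht]
  exact hF

end Push

/-! ### The assembly -/

section Main

/-- **[LSW] Theorem 6.1 transposed to Dobrushin domains, from the printed theorems, with
uniqueness in law of chordal SLE only at `κ = 8/3`.** The same statement and proof as
`IsSLELaw.hullRestriction_eightThirds_of_facts` below, except that the hypothesis `h₃`
(`IsSLECurve.map_eq`: two chordal SLE_κ random curves of a Dobrushin domain have the same law,
for EVERY `κ`) is only assumed at `κ = 8/3` — the single value at which the proof uses it (to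
realise the SLE_{8/3} law of the hull subdomain `D'` through the uniformizing map
`φ ∘ Φ_A⁻¹`). This keeps the SLE₈ trace theorem (which enters `IsSLECurve.map_eq` through SLE
scaling in law for all `κ`) out of the hypotheses of [LSW] Thm. 6.1 for SLE_{8/3}.
[cite: LawlerSchrammWerner2003Restriction, Thm. 6.1 (p. 23) with Prop. 3.3 (3) ⇒ (1) (p. 11) and Lemma 3.2 (p. 10)] -/
theorem IsSLELaw.hullRestriction_eightThirds_of_facts_at (h61 : sle_restriction_eightThirds)
    (hexΦ : IsStarHull.existsUnique_isRestrictionMap)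
    (hex : IsStarHull.exists_hasRestrictionDeriv) (hFc : HasRestrictionDeriv.tendsto_of_kernel)
    (hFa : isSimplyConnected_of_isConnected_compl)
    (hsc : ∀ D : JordanDomain, D.isSimplyConnected) (hJ : Literature.Topology.PlaneTopology.JordanCurveTheorem)
    (hJarc : Literature.Topology.PlaneTopology.JordanArcSeparation) (hRM : ∀ {U : Set ℂ}, exists_conformalEquiv_ball (U := U))
    (hC : JordanDomain.exists_continuousOn_extension) (hκt : HasSLETrace ((8 : ℝ≥0) / 3))
    (h₆ : RandomPlanarGeometry.ae_isSimpleTrace_sleTrace_of_le_four (κ := (8 : ℝ≥0) / 3))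
    (htr : tendsto_norm_sleTrace_atTop)
    (h₃ : ∀ {D : DobrushinDomain} {Γ Γ' : (ℝ≥0 → ℝ) → CurveClass ℂ},
      IsSLECurve ((8 : ℝ≥0) / 3) D Γ → IsSLECurve ((8 : ℝ≥0) / 3) D Γ' →
        Process.preWienerMeasure.map Γ = Process.preWienerMeasure.map Γ')
    (hmeas : aemeasurable_sleTrace) : IsSLELaw.hullRestriction_eightThirds := by
  classical
  intro D D' μ μ' hμ hμ' hD' T hT
  -- constants and derived classical inputs
  have hκ0 : (0 : ℝ≥0) < 8 / 3 := by positivity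
  have hκ4 : (8 : ℝ≥0) / 3 ≤ 4 := by
    rw [div_le_iff₀ (by norm_num : (0 : ℝ≥0) < 3)]
    norm_num
  haveI hP : IsProbabilityMeasure Process.preWienerMeasure :=
    ⟨sle_restriction_eightThirds.measure_univ h61⟩
  have hext : JordanDomain.continuousOn_boundaryExtension :=
    JordanDomain.continuousOn_boundaryExtension_of_disc hC
  have h₈ : JordanDomain.mapsTo_boundaryExtension := JordanDomain.mapsTo_boundaryExtension_of_disc hC
  have h₉ : CurveClass.measurableSet_simple (E := ℂ) := CurveClass.measurableSet_simple_holds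
  -- the SLE curve of `D`, its uniformizing map `φ`, the pulled-back hull and `Φ = Φ_A`
  obtain ⟨Γ, hΓ, rfl⟩ := hμ
  obtain ⟨hΓm, φ, hφ, hΓae⟩ := hΓ
  have hA : IsStarHull (φ.pullbackHull D') := IsStarHull.pullbackHull hsc hφ hD'
  have hAc : IsClosed (φ.pullbackHull D') := hA.isBoundedHull.isClosed
  obtain ⟨Φ, hΦ, -⟩ := hexΦ hA
  -- the uniformizing map `ψ = φ ∘ Φ⁻¹` of `D'` and the SLE law of `D'` through it
  set ψ : ConformalEquiv upperHalfPlaneSet D'.carrier :=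
    Φ.symm.trans (φ.restrHull D' hD'.carrier_subset) with hψdef
  have hψ : D'.IsChordalUniformizing ψ :=
    MarkedDomain.IsChordalUniformizing.pullback hsc hRM hC hφ hD' hΦ
  have hψsymm : ∀ w, ψ.symm w = Φ (φ.symm w) := fun w ↦ rfl
  obtain ⟨Γ', rfl, hΓ'm, hΓ'ae⟩ : ∃ Γ' : (ℝ≥0 → ℝ) → CurveClass ℂ,
      μ' = Process.preWienerMeasure.map Γ' ∧ AEMeasurable Γ' Process.preWienerMeasure ∧
      ∀ᵐ ω ∂Process.preWienerMeasure, Loewner.IsGeneratedByCurve (sleDriving ((8 : ℝ≥0) / 3) ω)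
          (sleTrace ((8 : ℝ≥0) / 3) ω) ∧
        ∃ c : Curve ℂ, Γ' ω = CurveClass.mk c ∧
          IsCompactifiedImage ψ.boundaryExtension (sleTrace ((8 : ℝ≥0) / 3) ω) (D'.pt 1) c := by
    obtain ⟨Γ', hΓ'm, hΓ'⟩ := exists_isSLECurve_through hκt hκ0 htr hext (hmeas hκt) hψ
    obtain ⟨Γ₀, hΓ₀, rfl⟩ := hμ'
    exact ⟨Γ', h₃ hΓ₀ (IsSLECurve.of_through hψ hΓ'm hΓ'), hΓ'm, hΓ'⟩
  have hΓsl : IsSLELaw ((8 : ℝ≥0) / 3) D (Process.preWienerMeasure.map Γ) := ⟨Γ, ⟨hΓm, φ, hφ, hΓae⟩, rfl⟩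
  have hΓ'sl : IsSLELaw ((8 : ℝ≥0) / 3) D' (Process.preWienerMeasure.map Γ') :=
    (IsSLECurve.of_through hψ hΓ'm hΓ'ae).isSLELaw_map
  haveI : IsProbabilityMeasure (Process.preWienerMeasure.map Γ') := Measure.isProbabilityMeasure_map hΓ'm
  -- the good event
  have hgood : ∀ᵐ ω ∂Process.preWienerMeasure,
      Loewner.IsGeneratedByCurve (sleDriving ((8 : ℝ≥0) / 3) ω) (sleTrace ((8 : ℝ≥0) / 3) ω) ∧
      Loewner.IsSimpleTrace (sleTrace ((8 : ℝ≥0) / 3) ω) ∧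
      Tendsto (fun t ↦ ‖sleTrace ((8 : ℝ≥0) / 3) ω t‖) atTop atTop ∧
      (∃ c : Curve ℂ, Γ ω = CurveClass.mk c ∧
        IsCompactifiedImage φ.boundaryExtension (sleTrace ((8 : ℝ≥0) / 3) ω) (D.pt 1) c) ∧
      (∃ c' : Curve ℂ, Γ' ω = CurveClass.mk c' ∧
        IsCompactifiedImage ψ.boundaryExtension (sleTrace ((8 : ℝ≥0) / 3) ω) (D'.pt 1) c') ∧
      (Γ ω ∈ CurveClass.simple ∧ (Γ ω).source = D.pt 0 ∧ (Γ ω).target = D.pt 1) := by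
    filter_upwards [hΓae, h₆ hκ0 hκ4, htr hκ0, hΓ'ae,
      ae_of_ae_map hΓm (hΓsl.ae_simple h₆ h₉ hκ0 hκ4), ae_of_ae_map hΓm (hΓsl.ae_endpoints h₈)]
      with ω hω hs ht hω' h1 h2
    exact ⟨hω.1, hs, ht, hω.2, hω'.2, h1.1, h2.1, h2.2.1⟩
  -- the events
  set V : Set (CurveClass ℂ) := CurveClass.rangeSubset (closure D'.carrier) with hVdef
  set R : Set (CurveClass ℂ) := chordalCarrier D' with hRdef
  have hVm : MeasurableSet V := CurveClass.measurableSet_rangeSubset isClosed_closure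
  have hRm : MeasurableSet R := measurableSet_chordalCarrier
  -- on the good event: `{γ ∩ A = ∅} ↔ Γ ∈ V ∩ R`, and `Γ ∈ V ⇒ γ(0,∞) ⊆ closure (ℍ ∖ A)`
  have hkey : ∀ᵐ ω ∂Process.preWienerMeasure,
      (Disjoint (range (sleTrace ((8 : ℝ≥0) / 3) ω)) (φ.pullbackHull D') ↔ Γ ω ∈ V ∩ R) ∧
      (Γ ω ∈ V → ∀ t, 0 < t →
        sleTrace ((8 : ℝ≥0) / 3) ω t ∈ closure (φ.pullbackDomain D')) := by
    filter_upwards [hgood] with ω ⟨_, hsimple, _, ⟨c, hΓω, hc⟩, _, hΓs, hΓsrc, hΓtgt⟩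
    have h0 : sleTrace ((8 : ℝ≥0) / 3) ω 0 = 0 := sleTrace_zero _ ω
    rw [hΓω] at hΓs hΓsrc hΓtgt ⊢
    refine ⟨?_, fun hV ↦
      forall_mem_closure_pullbackDomain hD'.carrier_subset hsimple.2 hc hV⟩
    rw [disjoint_range_pullbackHull_iff hφ hD' h0 hsimple.2 hc]
    constructor
    · intro hr
      exact ⟨subset_closure_of_subset_carrier_union hr,
        ⟨⟨hΓs, hΓsrc.trans hD'.pt_zero_eq.symm⟩, hΓtgt.trans hD'.pt_one_eq.symm⟩, hr⟩
    · rintro ⟨-, hR⟩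
      exact hR.2
  -- `μ V = P[γ ∩ A = ∅] = μ (V ∩ R)` (touching without entering is null, `HullRestrictionNull`)
  have hT6 := measure_subset_closure_le_measure_avoid hφ hD' h61 hexΦ hex hFc hFa hsc hJ hC hκt h₆ htr
  have hmapV : Process.preWienerMeasure.map Γ V = Process.preWienerMeasure (Γ ⁻¹' V) :=
    Measure.map_apply_of_aemeasurable hΓm hVm
  have hmapVR : Process.preWienerMeasure.map Γ (V ∩ R) = Process.preWienerMeasure (Γ ⁻¹' (V ∩ R)) :=
    Measure.map_apply_of_aemeasurable hΓm (hVm.inter hRm)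
  have hle1 : Process.preWienerMeasure (Γ ⁻¹' V) ≤ Process.preWienerMeasure {ω | ∀ t, 0 < t →
      sleTrace ((8 : ℝ≥0) / 3) ω t ∈ closure (φ.pullbackDomain D')} :=
    measure_mono_ae (hkey.mono fun ω hω hV ↦ hω.2 hV)
  have hle2 : Process.preWienerMeasure {ω | Disjoint (range (sleTrace ((8 : ℝ≥0) / 3) ω))
      (φ.pullbackHull D')} ≤ Process.preWienerMeasure (Γ ⁻¹' (V ∩ R)) :=
    measure_mono_ae (hkey.mono fun ω hω hE ↦ hω.1.1 hE)
  have hle3 : Process.preWienerMeasure (Γ ⁻¹' (V ∩ R)) ≤ Process.preWienerMeasure (Γ ⁻¹' V) :=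
    measure_mono (preimage_mono inter_subset_left)
  have hVEA : Process.preWienerMeasure.map Γ V =
      Process.preWienerMeasure {ω | Disjoint (range (sleTrace ((8 : ℝ≥0) / 3) ω)) (φ.pullbackHull D')} := by
    rw [hmapV]
    exact le_antisymm (hle1.trans hT6) (hle2.trans hle3)
  have hVR : Process.preWienerMeasure.map Γ (V ∩ R) = Process.preWienerMeasure.map Γ V := by
    rw [hmapV, hmapVR]
    exact le_antisymm hle3 ((hle1.trans hT6).trans hle2)
  have hVsubR : ∀ᵐ x ∂Process.preWienerMeasure.map Γ, x ∈ V → x ∈ R := by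
    have hsum := measure_inter_add_sdiff (μ := Process.preWienerMeasure.map Γ) V hRm
    rw [hVR] at hsum
    have hnull : Process.preWienerMeasure.map Γ (V \ R) = 0 :=
      (ENNReal.add_right_inj (measure_ne_top _ _)).1 (hsum.trans (add_zero _).symm)
    filter_upwards [measure_eq_zero_iff_ae_notMem.1 hnull] with x hx hxV
    by_contra hxR
    exact hx ⟨hxV, hxR⟩
  have hVsubR' := ae_of_ae_map hΓm hVsubR
  -- the two finite measures `μ V • μ'` and `μ|_V` agree: transfer through the avoidance code
  set m : ℝ≥0 := (Process.preWienerMeasure.map Γ V).toNNReal with hmdef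
  have hmcoe : (m : ℝ≥0∞) = Process.preWienerMeasure.map Γ V := ENNReal.coe_toNNReal (measure_ne_top _ _)
  have hident : m • Process.preWienerMeasure.map Γ' = (Process.preWienerMeasure.map Γ).restrict V := by
    refine CurveClass.Measure.ext_of_missCode_injOn (C := imageTest ψ)
      (fun n ↦ isClosed_imageTest hC n) hRm (injOn_missCode_imageTest hJarc hC hψ) ?_ ?_ ?_
    · refine Measure.ae_smul_measure ?_ _
      filter_upwards [hΓ'sl.ae_simple h₆ h₉ hκ0 hκ4, hΓ'sl.ae_endpoints h₈] with x h1 h2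
      exact ⟨⟨⟨h1.1, h2.1⟩, h2.2.1⟩, subset_carrier_union_of_inter_frontier h2.2.2 h1.2⟩
    · rw [ae_restrict_iff' hVm]
      exact hVsubR
    · intro s
      obtain ⟨hS0, hSc, hSsub, h0S⟩ := biUnion_anchoredSeq s
      have havm : MeasurableSet (CurveClass.rangeSubset
          (ψ.boundaryExtension '' ⋃ n ∈ s, anchoredSeq n)ᶜ : Set (CurveClass ℂ)) :=
        CurveClass.measurableSet_rangeSubset_compl
          (MarkedDomain.isCompact_image_boundaryExtension hC hSsub hSc).isClosed
      rw [biUnion_imageTest, Measure.coe_nnreal_smul_apply, hmcoe, Measure.restrict_apply havm,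
        Measure.map_apply_of_aemeasurable hΓ'm havm,
        Measure.map_apply_of_aemeasurable hΓm (havm.inter hVm), hVEA]
      rcases hS0 with hS0 | hSanch
      · -- the empty test set: both sides are `μ V`
        have hav : (CurveClass.rangeSubset
            (ψ.boundaryExtension '' ⋃ n ∈ s, anchoredSeq n)ᶜ : Set (CurveClass ℂ)) = univ := by
          rw [hS0, image_empty, compl_empty]
          exact eq_univ_of_forall fun c ↦ subset_univ _
        rw [hav, preimage_univ, measure_univ, mul_one, univ_inter, ← hmapV, hVEA]
      · have hScl : IsClosed (⋃ n ∈ s, anchoredSeq n) := hSc.isClosed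
        have hSb : Bornology.IsBounded (⋃ n ∈ s, anchoredSeq n) := hSc.isBounded
        -- `μ' {Γ' ∩ ψ(S) = ∅} = P[γ ∩ S = ∅]`
        have hL : Process.preWienerMeasure (Γ' ⁻¹' CurveClass.rangeSubset
            (ψ.boundaryExtension '' ⋃ n ∈ s, anchoredSeq n)ᶜ) =
            Process.preWienerMeasure {ω | Disjoint (range (sleTrace ((8 : ℝ≥0) / 3) ω))
              (⋃ n ∈ s, anchoredSeq n)} := by
          refine measure_congr (eventuallyEq_set.2 ?_)
          filter_upwards [hgood] with ω ⟨_, hsimple, _, _, ⟨c', hΓ'ω, hc'⟩, _⟩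
          rw [mem_preimage, hΓ'ω]
          exact hc'.mk_mem_rangeSubset_compl_image_iff hψ (sleTrace_zero _ ω) hsimple.2 hC hSsub h0S
        -- `μ ({Γ ∩ ψ(S) = ∅} ∩ V) = P[γ ∩ A = ∅, Φ_A(γ) ∩ S = ∅]`
        have hRt : Process.preWienerMeasure (Γ ⁻¹' (CurveClass.rangeSubset
            (ψ.boundaryExtension '' ⋃ n ∈ s, anchoredSeq n)ᶜ ∩ V)) =
            Process.preWienerMeasure {ω | Disjoint (range (sleTrace ((8 : ℝ≥0) / 3) ω))
              (φ.pullbackHull D') ∧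
              ∀ t, 0 < t → Φ (sleTrace ((8 : ℝ≥0) / 3) ω t) ∉ ⋃ n ∈ s, anchoredSeq n} := by
          refine measure_congr (eventuallyEq_set.2 ?_)
          filter_upwards [hgood, hkey, hVsubR'] with ω ⟨_, hsimple, _, ⟨c, hΓω, hc⟩, _⟩ hk hVR'
          rw [mem_preimage]
          constructor
          · rintro ⟨hav, hV⟩
            have hE : Disjoint (range (sleTrace ((8 : ℝ≥0) / 3) ω)) (φ.pullbackHull D') :=
              hk.1.2 ⟨hV, hVR' hV⟩
            refine ⟨hE, ?_⟩
            rw [hΓω] at hav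
            exact (mk_mem_rangeSubset_compl_image_iff_of_disjoint hC hφ hD' hψ hψsymm
              (sleTrace_zero _ ω) hsimple.2 hc hE hSsub h0S).1 hav
          · rintro ⟨hE, hav⟩
            refine ⟨?_, (hk.1.1 hE).1⟩
            rw [hΓω]
            exact (mk_mem_rangeSubset_compl_image_iff_of_disjoint hC hφ hD' hψ hψsymm
              (sleTrace_zero _ ω) hsimple.2 hc hE hSsub h0S).2 hav
        rw [hL, hRt]
        by_cases h0F : (0 : ℂ) ∈ hpFill (⋃ n ∈ s, anchoredSeq n)
        · -- `0` is enclosed by `S`: both events are null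
          have hL0 : Process.preWienerMeasure {ω | Disjoint (range (sleTrace ((8 : ℝ≥0) / 3) ω))
              (⋃ n ∈ s, anchoredSeq n)} = 0 := by
            refine measure_eq_zero_iff_ae_notMem.2 ?_
            filter_upwards [hgood] with ω ⟨hgen, hsimple, htr', _⟩ hdisj
            exact zero_notMem_hpFill_of_disjoint hScl hgen.continuous (sleTrace_zero _ ω)
              hsimple.2 htr' hdisj h0F
          have hR0 : Process.preWienerMeasure {ω | Disjoint (range (sleTrace ((8 : ℝ≥0) / 3) ω))
              (φ.pullbackHull D') ∧
              ∀ t, 0 < t → Φ (sleTrace ((8 : ℝ≥0) / 3) ω t) ∉ ⋃ n ∈ s, anchoredSeq n} = 0 := by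
            refine measure_eq_zero_iff_ae_notMem.2 ?_
            filter_upwards [hgood] with ω ⟨hgen, hsimple, htr', _⟩ hω
            exact (hΦ.forall_notMem_hpFill hAc hgen.continuous (sleTrace_zero _ ω) hsimple.2
              htr' hω.1 hScl hSb h0S hω.2).1 h0F
          rw [hL0, hR0, mul_zero]
        · -- the fill `B` of `S` is a `*`-hull: Thm. 6.1 and the semigroup identity
          have hB : IsStarHull (hpFill (⋃ n ∈ s, anchoredSeq n)) :=
            isStarHull_hpFill hFa hScl hSb hSanch.2 h0F
          obtain ⟨ΦB, hΦB, -⟩ := hexΦ hB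
          have hL1 : Process.preWienerMeasure {ω | Disjoint (range (sleTrace ((8 : ℝ≥0) / 3) ω))
              (⋃ n ∈ s, anchoredSeq n)} =
              Process.preWienerMeasure {ω | Disjoint (range (sleTrace ((8 : ℝ≥0) / 3) ω))
                (hpFill (⋃ n ∈ s, anchoredSeq n))} := by
            refine measure_congr (eventuallyEq_set.2 ?_)
            filter_upwards [hgood] with ω ⟨hgen, hsimple, htr', _⟩
            exact (disjoint_range_hpFill_iff hScl hSb h0S hgen.continuous (sleTrace_zero _ ω)
              hsimple.2 htr').symm
          have hR1 : Process.preWienerMeasure {ω | Disjoint (range (sleTrace ((8 : ℝ≥0) / 3) ω))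
              (φ.pullbackHull D') ∧
              ∀ t, 0 < t → Φ (sleTrace ((8 : ℝ≥0) / 3) ω t) ∉ ⋃ n ∈ s, anchoredSeq n} =
              Process.preWienerMeasure {ω | Disjoint (range (sleTrace ((8 : ℝ≥0) / 3) ω))
                (φ.pullbackHull D') ∧
                ∀ t, 0 < t → Φ (sleTrace ((8 : ℝ≥0) / 3) ω t) ∉
                  hpFill (⋃ n ∈ s, anchoredSeq n)} := by
            refine measure_congr (eventuallyEq_set.2 ?_)
            filter_upwards [hgood] with ω ⟨hgen, hsimple, htr', _⟩
            refine and_congr_right fun hE ↦ ⟨fun hav ↦ ?_, fun hav t ht hS' ↦ ?_⟩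
            · exact (hΦ.forall_notMem_hpFill hAc hgen.continuous (sleTrace_zero _ ω) hsimple.2
                htr' hE hScl hSb h0S hav).2
            · exact hav t ht (inter_subset_hpFill _ ⟨hS', Φ.mapsTo
                ⟨hsimple.2 t ht, Set.disjoint_left.1 hE (mem_range_self t)⟩⟩)
          rw [hL1, hR1, sle_restriction_eightThirds.measure_avoid_and_comp_avoid h61 hex h₆ hB hA
            hΦB hΦ]
  -- evaluate the identity of measures at `T`
  have hTeq : (m • Process.preWienerMeasure.map Γ') T = (Process.preWienerMeasure.map Γ).restrict V T := by
    rw [hident]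
  rw [Measure.coe_nnreal_smul_apply, Measure.restrict_apply hT, hmcoe] at hTeq
  rw [mul_comm]
  exact hTeq

/-- **[LSW] Theorem 6.1 transposed to Dobrushin domains, from the printed theorems**:
`Literature.Probability.RandomPlanarGeometry.IsSLELaw.hullRestriction_eightThirds` — for the chordal SLE_{8/3} laws `μ`, `μ'` of
`(D; a, b)` and of a hull subdomain `D'`, `μ' (T) · μ {Γ ⊆ cl D'} = μ (T ∩ {Γ ⊆ cl D'})` for
every Borel `T` — follows from [LSW] Thm. 6.1 in the half-plane (`h61`,
`sle_restriction_eightThirds`: `P[γ ∩ A = ∅] = Φ'_A(0)^{5/8}` for `A ∈ 𝒬*`), the existence and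
uniqueness of the maps `Φ_A` and numbers `Φ'_A(0)` ([LSW] §2; `hexΦ`, `hex`), the continuity of
`Φ'_·(0)` under kernel convergence ([LSW] Lemma 3.5; `hFc`), and classical theorems: simple
connectivity criterion (`hFa`), Jordan–Schoenflies (`hsc`), Jordan curve and arc theorems
(`hJ`, `hJarc`), Riemann mapping (`hRM`), Carathéodory (`hC`), and Rohde–Schramm (`hκt`, `h₆`,
`htr`, `h₃`, `hmeas`). See the module docstring for the proof.
[cite: LawlerSchrammWerner2003Restriction, Thm. 6.1 (p. 23) with Prop. 3.3 (3) ⇒ (1) (p. 11) and Lemma 3.2 (p. 10)] -/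
theorem IsSLELaw.hullRestriction_eightThirds_of_facts (h61 : sle_restriction_eightThirds)
    (hexΦ : IsStarHull.existsUnique_isRestrictionMap)
    (hex : IsStarHull.exists_hasRestrictionDeriv) (hFc : HasRestrictionDeriv.tendsto_of_kernel)
    (hFa : isSimplyConnected_of_isConnected_compl)
    (hsc : ∀ D : JordanDomain, D.isSimplyConnected) (hJ : Literature.Topology.PlaneTopology.JordanCurveTheorem)
    (hJarc : Literature.Topology.PlaneTopology.JordanArcSeparation) (hRM : ∀ {U : Set ℂ}, exists_conformalEquiv_ball (U := U))
    (hC : JordanDomain.exists_continuousOn_extension) (hκt : HasSLETrace ((8 : ℝ≥0) / 3))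
    (h₆ : RandomPlanarGeometry.ae_isSimpleTrace_sleTrace_of_le_four (κ := (8 : ℝ≥0) / 3))
    (htr : tendsto_norm_sleTrace_atTop) (h₃ : IsSLECurve.map_eq)
    (hmeas : aemeasurable_sleTrace) : IsSLELaw.hullRestriction_eightThirds :=
  IsSLELaw.hullRestriction_eightThirds_of_facts_at h61 hexΦ hex hFc hFa hsc hJ hJarc hRM hC hκt h₆ htr
    (fun hΓ hΓ' ↦ h₃ hΓ hΓ') hmeas

/-- **`Literature.Probability.RandomPlanarGeometry.LawlerSchrammWerner2003` from the uniqueness theorem of [LSW] and printed classical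
theorems.** As `LawlerSchrammWerner2003_of_printed_facts` (`ConformalRestrictionAssembly`),
with the restriction property of SLE_{8/3} (`h₄`) now DERIVED from [LSW] Thm. 6.1 in its
printed half-plane form (`h61`) by `IsSLELaw.hullRestriction_eightThirds_of_facts`; the only
remaining hypothesis specific to the paper's second result is the uniqueness half `hU`
(Prop. 3.3 with Lemma 3.2, Thm. 7.3, Cor. 8.6). [cite: LawlerSchrammWerner2003Restriction, p. 5 result 2 with Thm. 6.1 (p. 23)] -/
theorem LawlerSchrammWerner2003_of_uniqueness (hW : Process.isProjectiveLimit_preWienerMeasure)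
    (h8 : hasSLETrace_eight) (hne : hasSLETrace_of_ne_eight) (htr : tendsto_norm_sleTrace_atTop)
    (hsc : ∀ D : JordanDomain, D.isSimplyConnected)
    (hRM : ∀ {U : Set ℂ}, exists_conformalEquiv_ball (U := U))
    (hC : JordanDomain.exists_continuousOn_extension) (hscale : identDistrib_sleTrace_scale)
    (h₆ : RandomPlanarGeometry.ae_isSimpleTrace_sleTrace_of_le_four (κ := (8 : ℝ≥0) / 3))
    (hJ : Literature.Topology.PlaneTopology.JordanCurveTheorem) (hJarc : Literature.Topology.PlaneTopology.JordanArcSeparation)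
    (hFa : isSimplyConnected_of_isConnected_compl) (h61 : sle_restriction_eightThirds)
    (hexΦ : IsStarHull.existsUnique_isRestrictionMap)
    (hex : IsStarHull.exists_hasRestrictionDeriv) (hFc : HasRestrictionDeriv.tendsto_of_kernel)
    (hU : LawlerSchrammWerner2003_unique) : LawlerSchrammWerner2003 :=
  LawlerSchrammWerner2003_of_printed_facts hW h8 hne htr hsc hRM hC hscale h₆ hU
    (IsSLELaw.hullRestriction_eightThirds_of_facts h61 hexΦ hex hFc hFa hsc hJ hJarc hRM hC
      (hasSLETrace h8 hne _) h₆ htr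
      (IsSLECurve.map_eq_of_facts
        (MarkedDomain.IsChordalUniformizing.exists_eq_trans_smul_of_disc hC) hscale
        (JordanDomain.continuousOn_boundaryExtension_of_disc hC))
      (aemeasurable_sleTrace_of_identDistrib hscale))

end Main

end Literature.Probability.RandomPlanarGeometry

end
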